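import Literature.MathematicalPhysics.QuantumFieldTheory.Borinsky2020.SectorTableRecursion
import HarnessLib

/-!
# Volkov's "fast sampling algorithm" for the Hepp-sector density (PRD 96 §III.C): the subset table `W(s)`, its dynamic-programming recurrence (23), the step law (24), the sector law of the generation loop — PROVED — and the dictionary to Borinsky 2020's `2ⁿ`-table `J_r`

independent recomputation; certified where stated, statistical where stated; no new-physics claim.

CITATION HEADER (venture `QEDPrecision`, cell `pub-qed`, track TROPICAL seat V3a = `pub-qed-trop-v3-lit-1` gen 8; VALUE-FREE: the SHAPE of
the printed sampling algorithm only — rational functions of the symbols `Deg(s)`; no integral is evaluated, no constant, nothing per graph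
or per Set V family). Serves `tropical/view/V3-VOLKOV-DEGREES.md` §A A.2.3 ("sector coordinates, exact normalisation and the sampling
algorithm") and the track's instrument leg (u1) "the sampling law's normalisation computed exactly by two routes": the discrete half of a
Volkov-2017-type sector sampler and of a Borinsky-2020-type sector sampler are ONE recursion (last section).

Source [Volkov2017]: S. Volkov, "New method of computing the contributions of graphs without lepton loops to the electron anomalous
magnetic moment in QED", Phys. Rev. D 96, 096018 (2017) = arXiv:1705.05800; e-print `amm4_mc_arxiv.tex` (deposited on the pub-qed HOME,
`data/lit/sources/.cache/1705.05800/`, sha256 3d5fd6a7…; equation numbers = the e-print's numbered `equation` environments in order,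
`\label` given beside; `\ffdeg` = Deg), §III.C "Fast sampling algorithm", VERBATIM.  §III.B (16) `eq_mc_g0` (tex l.585–594; PDF p.11):
"We define the function g₀(z₁,…,z_n) on S_{j₁,…,j_n} by the following relation g₀(z₁,…,z_n) = ∏_{l=2}^{n}
(z_{j_l}/z_{j_{l−1}})^{Deg({j_l,j_{l+1},…,j_n})} / (z₁z₂⋯z_n), where Deg(s) > 0 is defined for each set s of internal lines of G except
the empty set and the set of all internal lines of G."  §III.C (tex l.838–1008; PDF p.16–18, heading at the foot of p.15; Lemma 1 p.16–17, the
displays after (21)/(22) with W, (23), (24) p.17, the t-densities, the whole integral and "The algorithm" p.18): "Suppose the numbers Deg(s) are fixed for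
each s ⊆ Λ, s ≠ Λ, s ≠ ∅, where Λ = {1,2,…,n}. To generate randomly a point (z₁,…,z_n) it is necessary to take two steps: generate
randomly a sector S_{j₁,…,j_n}; generate a point inside this sector. We generate a sector without brute forcing all sectors [footnote:
In 5-loop case we have n = 14 … and 87178291200 sectors for each of 389 families of Feynman graphs. However, what is needed is only to
take 2ⁿ = 16384 subsets for each family.] at all stages of the calculation. We use the dynamic programming approach instead at the
initialization stage. To generate sectors with correct probabilities it is required to know the value
∫_{z>0, z∈S_{j₁,…,j_n}} g₀(z₁,…,z_n) δ(z₁+…+z_n−1) dz₁…dz_n, (19) [`eq_g0_integral`] … for each sector S_{j₁,…,j_n}." [Lemma 1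
`lemma_sum_to_max` (the projective ↔ affine chart), (20) `eq_jacobian`, (21) `eq_subst_zy` z_{j_l} = y_l/(1+y₂+…+y_n), (22) `eq_subst_yt`
t_l = y_l/y_{l−1}] "we obtain that it equals 1/∏_{l=2}^{n} Deg({j_l,j_{l+1},…,j_n}).  For generating sector permutations
element-by-element we will use the function W(s) = Σ_{j₁,…,j_{|s|} ∈ s are distinct} 1/∏_{l=1}^{|s|} Deg({j_l,j_{l+1},…,j_{|s|}}) that is
defined on all proper subsets of Λ. The function W satisfies the recurrence relations: W(s) = Σ_{l∈s} W(s∖{l}) / Deg(s), s ≠ ∅,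
W(∅) = 1. (23) [`eq_dyn_prog`] When the permutation prefix j₁,j₂,…,j_{l−1} has already been generated, the probability that j_l = a is
equal to P[Λ∖{j₁,…,j_{l−1}}, a], where P[s,a] = W(s∖{a}) / Σ_{a′∈s} W(s∖{a′}). (24) [`eq_next_prob`] … For calculating the probability
density at a given point it is needed to know the whole integral ∫_{z>0} g₀(z₁,…,z_n) δ(z₁+…+z_n−1) dz₁…dz_n. It equals
Σ_{a∈Λ} W(Λ∖{a}).  The algorithm. Initialization part. 1. Calculate W(s) for all s ⊆ Λ using (23). 2. Calculate P[s,a] for all s ⊆ Λ,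
s ≠ ∅, a ∈ s using (24). Generation part. 1. Generation of a sector. for l := 1 to n do put j_l = a with the probability
P[Λ∖{j₁,…,j_{l−1}}, a]; 2. Generation of a point. Generate r₂,…,r_n ∈ [0;1] using the uniform distribution. Put
t_l = r_l^{1/Deg({j_l,…,j_n})}, 2 ≤ l ≤ n. …"

Source [Borinsky2020] (for the dictionary): M. Borinsky, Ann. Inst. Henri Poincaré D 10 (2023) 635 = arXiv:2008.12310, §6.2 eq. (40),
Definition 28 ("J_r(A) = Σ_{e∈A} J_r(A∖e)/r(A∖e) … J_r(∅) = 1", "it will be convenient to declare r(∅) = 1"), Proposition 29, Algorithm 4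
("Pick a random e ∈ A with probability p_e = (1/J_r(A)) · J_r(A∖e)/r(A∖e)"), "Compared to the naiver approach where a table of size n! is
needed, only a table of size 2ⁿ is required" — typed and proved in `Borinsky2020/SectorTableRecursion.lean` (`sectorTable` = J_r,
`orderings`, `orderingWeight`, `stepProb` = p_e, `runProb`), which this file REUSES and does not re-declare.  Bibliographic note
(value-free, checked on both e-prints): neither text cites the other; both cite Speer (PRD 96 ref. "E. Speer, J. Math. Phys. 9, 1404
(1968)"; arXiv:2008.12310 "[Speer:1975dc]").

TYPING. Ground set: any type `ι` with decidable equality; `Deg : Finset ι → ℝ` (Volkov fixes Deg only on the non-empty proper subsets of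
Λ — every statement below evaluates it only there, except where said); a SECTOR S_{j₁,…,j_n}, z_{j₁} ≥ ⋯ ≥ z_{j_n}, is the list
`[j₁, …, j_n]` (LARGEST parameter first = the order in which the generation loop produces the labels) — these lists are exactly
Borinsky's `orderings Λ` (the duplicate-free lists with element set Λ, listed in his Algorithm 4's REMOVAL order, which is the same
order), and Volkov's TAIL SETS {j_l,…,j_n} are the element sets of the list's suffixes.
* `tailWeight Deg [j₁,…,j_m] = 1/∏_{l=1}^{m} Deg({j_l,…,j_m})` — the summand of W (display before (23));
* `tableW Deg s = W(s)` DEFINED as printed (the sum over orderings of s), `tableW_empty`, and **`tableW_eq` = the recurrence (23)**,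
  which the paper states without proof ("The function W satisfies the recurrence relations") — PROVED, for every `Deg`;
* `totalW Deg Λ = Σ_{a∈Λ} W(Λ∖{a})` (the printed value of the whole integral of g₀), `nextProb Deg s a = P[s,a]` ((24)),
  `sum_nextProb` (P[s,·] is a probability vector), `tableW_pos` / `totalW_pos` (W > 0, Σ_a W(Λ∖{a}) > 0 whenever Deg > 0 on the
  non-empty (proper) subsets — the printed "Deg(s) > 0");
* `sectorIntegral Deg [j₁,…,j_n] = 1/∏_{l=2}^{n} Deg({j_l,…,j_n})` (the printed value of (19)), `sum_sectorIntegral`: summed over all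
  sectors it gives Σ_{a∈Λ} W(Λ∖{a}) (the printed value of the whole integral — consistency of the two displays);
* `genProb Deg Λ [j₁,…,j_n]` = the probability that "Generation part 1" outputs the sector (product of the P's along the loop), and
  **`genProb_eq`: it equals sectorIntegral / totalW**, i.e. (sector integral of g₀)/(whole integral) with both factors at their printed
  values — "To generate sectors with correct probabilities" made a theorem about the loop; `sum_genProb` (= 1).
* DICTIONARY (last section, under Borinsky's printed convention `Deg ∅ = 1`, which Volkov never needs — `tableW_congr` shows W(s)
  ignores `Deg ∅`): `tailWeight = orderingWeight / Deg(set)`, **`tableW_eq_sectorTable_div`: W(s) = J_{Deg}(s)/Deg(s)**,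
  **`totalW_eq_sectorTable`: Σ_{a∈Λ} W(Λ∖{a}) = J_{Deg}(Λ)**, `nextProb_eq_stepProb`: P[s,a] = p_a, `genProb_eq_runProb`,
  `sectorIntegral_eq_orderingWeight` — the 2017 "dynamic programming" table and the 2020 "2ⁿ-table" are the same recursion up to
  the factor Deg(s), and the two sector-generation loops have the same law.
NOT typed here: the continuous statements — Lemma 1 (the projective change of variables), that (19) EQUALS 1/∏Deg (Panzer's
Hepp-sector monomial integral is `Borinsky2020.integral_heppCube_monomial`; the instantiation with Volkov's telescoping exponents is not
made here), the point-generation step t_l = r_l^{1/Deg}, and anything about Deg itself (`SamplingDegree.lean`,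
`SamplingDegreePositivity.lean`) or about g₀ as a density (normalisability is `totalW_pos` only in the sense that the printed normaliser
is positive).
-/

namespace Literature.MathematicalPhysics.QuantumFieldTheory.Volkov2017

open Finset
open Borinsky2020

variable {ι : Type*} [DecidableEq ι]

/-! ## Orderings of a finite set, decomposed by their first element (facts about `Borinsky2020.orderings`) -/

section Orderings

/-- The only ordering of `∅` is the empty list. [cite: Borinsky2020, §6.2 Definition 28 / proof of Proposition 29 (J_r(∅) = 1, the
empty bijection)] -/
theorem orderings_empty : orderings (∅ : Finset ι) = {[]} := by
  ext l
  rw [mem_orderings, mem_singleton]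
  constructor
  · rintro ⟨-, h⟩
    exact (List.toFinset_eq_empty_iff _).mp h
  · rintro rfl
    simp

/-- `s.toList` is an ordering of `s`; in particular orderings exist. [cite: Borinsky2020, §6.2 proof of Proposition 29] -/
theorem toList_mem_orderings (s : Finset ι) : s.toList ∈ orderings s :=
  mem_orderings.mpr ⟨s.nodup_toList, s.toList_toFinset⟩

/-- The set of orderings of `s` is non-empty. [cite: Borinsky2020, §6.2 proof of Proposition 29] -/
theorem orderings_nonempty (s : Finset ι) : (orderings s).Nonempty := ⟨_, toList_mem_orderings s⟩

/-- "Fixing such a bijection is equivalent to fixing a pair (e, µ) of an element e ∈ A and a bijection µ : [m−1] → A∖e": a list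
`e :: t` is an ordering of `s` iff `e ∈ s` and `t` is an ordering of `s ∖ {e}`. [cite: Borinsky2020, §6.2 proof of Proposition 29] -/
theorem mem_orderings_cons {s : Finset ι} {e : ι} {t : List ι} :
    e :: t ∈ orderings s ↔ e ∈ s ∧ t ∈ orderings (s.erase e) := by
  rw [mem_orderings, mem_orderings, List.nodup_cons, List.toFinset_cons]
  constructor
  · rintro ⟨⟨het, hnd⟩, hs⟩
    refine ⟨by rw [← hs]; exact mem_insert_self _ _, hnd, ?_⟩
    rw [← hs, erase_insert (fun hm => het (List.mem_toFinset.mp hm))]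
  · rintro ⟨he, hnd, ht⟩
    refine ⟨⟨fun hm => ?_, hnd⟩, ?_⟩
    · have h : e ∈ t.toFinset := List.mem_toFinset.mpr hm
      rw [ht] at h
      exact notMem_erase e s h
    · rw [ht, insert_erase he]

/-- The orderings of a non-empty `s`, grouped by their first element. [cite: Borinsky2020, §6.2 proof of Proposition 29] -/
theorem orderings_eq_biUnion {s : Finset ι} (hs : s.Nonempty) :
    orderings s = s.biUnion fun e => (orderings (s.erase e)).image (List.cons e) := by
  ext l
  rw [mem_biUnion]
  constructor
  · intro hl
    cases l with
    | nil =>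
      obtain ⟨-, h⟩ := mem_orderings.mp hl
      rw [List.toFinset_nil] at h
      exact absurd h.symm hs.ne_empty
    | cons e t =>
      obtain ⟨he, ht⟩ := mem_orderings_cons.mp hl
      exact ⟨e, he, mem_image.mpr ⟨t, ht, rfl⟩⟩
  · rintro ⟨e, he, hl⟩
    obtain ⟨t, ht, rfl⟩ := mem_image.mp hl
    exact mem_orderings_cons.mpr ⟨he, ht⟩

/-- A sum over the orderings of a non-empty `s` = the sum over the first element `e ∈ s` and the orderings of `s ∖ {e}` ("Decomposing
the sum in this way …"). [cite: Borinsky2020, §6.2 proof of Proposition 29] -/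
theorem sum_orderings_eq {s : Finset ι} (hs : s.Nonempty) (f : List ι → ℝ) :
    ∑ l ∈ orderings s, f l = ∑ e ∈ s, ∑ t ∈ orderings (s.erase e), f (e :: t) := by
  rw [orderings_eq_biUnion hs, sum_biUnion]
  · refine sum_congr rfl fun e _ => ?_
    rw [sum_image fun t _ t' _ h => List.tail_eq_of_cons_eq h]
  · intro e _ e' _ hne
    simp only [Function.onFun]
    refine disjoint_left.mpr fun l hl hl' => hne ?_
    obtain ⟨t, -, rfl⟩ := mem_image.mp hl
    obtain ⟨t', -, h'⟩ := mem_image.mp hl'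
    exact (List.head_eq_of_cons_eq h').symm

end Orderings

/-! ## The table `W`, its recurrence (23), the step law (24) -/

section Table

/-- Volkov's summand: for a sector / ordering `[j₁, …, j_m]` (largest parameter first) the number
`1/∏_{l=1}^{m} Deg({j_l, j_{l+1}, …, j_m})` — one factor per TAIL SET, the full set included, the empty set excluded.
[cite: Volkov2017, §III.C (display before eq. (23) `eq_dyn_prog`, tex l.937–941)] -/
noncomputable def tailWeight (Deg : Finset ι → ℝ) : List ι → ℝ
  | [] => 1
  | j :: t => tailWeight Deg t / Deg (j :: t).toFinset

/-- `tailWeight Deg [] = 1` (empty product). [cite: Volkov2017, §III.C (display before eq. (23))] -/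
@[simp] theorem tailWeight_nil (Deg : Finset ι → ℝ) : tailWeight Deg ([] : List ι) = 1 := rfl

/-- `tailWeight Deg (j :: t) = tailWeight Deg t / Deg({j} ∪ t)`. [cite: Volkov2017, §III.C (display before eq. (23))] -/
@[simp] theorem tailWeight_cons (Deg : Finset ι → ℝ) (j : ι) (t : List ι) :
    tailWeight Deg (j :: t) = tailWeight Deg t / Deg (j :: t).toFinset := rfl

/-- `tailWeight` of an ordering of `s` evaluates `Deg` only on non-empty subsets of `s`. [cite: Volkov2017, §III.C ("Suppose the
numbers Deg(s) are fixed for each s ⊆ Λ, s ≠ Λ, s ≠ ∅")] -/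
theorem tailWeight_congr {Deg Deg' : Finset ι → ℝ} {s : Finset ι} (h : ∀ t : Finset ι, t.Nonempty → t ⊆ s → Deg t = Deg' t)
    {l : List ι} (hl : l ∈ orderings s) : tailWeight Deg l = tailWeight Deg' l := by
  induction l generalizing s with
  | nil => rfl
  | cons j t ih =>
    obtain ⟨hj, ht⟩ := mem_orderings_cons.mp hl
    have hset : (j :: t).toFinset = s := (mem_orderings.mp hl).2
    rw [tailWeight_cons, tailWeight_cons, hset, h s ⟨j, hj⟩ Subset.rfl,
      ih (fun u hu hus => h u hu (hus.trans (erase_subset j s))) ht]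

/-- **Volkov's table** "W(s) = Σ_{j₁,…,j_{|s|} ∈ s are distinct} 1/∏_{l=1}^{|s|} Deg({j_l, j_{l+1}, …, j_{|s|}})", DEFINED as printed
(the sum over the orderings of `s`). [cite: Volkov2017, §III.C (display before eq. (23) `eq_dyn_prog`, tex l.935–942)] -/
noncomputable def tableW (Deg : Finset ι → ℝ) (s : Finset ι) : ℝ := ∑ l ∈ orderings s, tailWeight Deg l

/-- `W(∅) = 1` (the second clause of (23): the only ordering of ∅ is the empty one). [cite: Volkov2017, §III.C eq. (23)] -/
theorem tableW_empty (Deg : Finset ι → ℝ) : tableW Deg (∅ : Finset ι) = 1 := by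
  rw [tableW, orderings_empty, sum_singleton, tailWeight_nil]

/-- **Eq. (23), the dynamic-programming recurrence**: "The function W satisfies the recurrence relations:
W(s) = Σ_{l∈s} W(s∖{l}) / Deg(s), s ≠ ∅" — stated without proof in print; here PROVED from the definition of W, for every `Deg`.
[cite: Volkov2017, §III.C eq. (23) `eq_dyn_prog` (tex l.942–947)] -/
theorem tableW_eq (Deg : Finset ι → ℝ) {s : Finset ι} (hs : s.Nonempty) :
    tableW Deg s = (∑ l ∈ s, tableW Deg (s.erase l)) / Deg s := by
  rw [tableW, sum_orderings_eq hs, sum_div]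
  refine sum_congr rfl fun e he => ?_
  rw [tableW, sum_div]
  refine sum_congr rfl fun t ht => ?_
  rw [tailWeight_cons, List.toFinset_cons, (mem_orderings.mp ht).2, insert_erase he]

/-- W(s) depends on `Deg` only through its values on the non-empty subsets of `s` (so a convention for `Deg ∅`, or for `Deg` off `s`,
is immaterial). [cite: Volkov2017, §III.C ("defined on all proper subsets of Λ")] -/
theorem tableW_congr {Deg Deg' : Finset ι → ℝ} {s : Finset ι} (h : ∀ t : Finset ι, t.Nonempty → t ⊆ s → Deg t = Deg' t) :
    tableW Deg s = tableW Deg' s :=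
  sum_congr rfl fun _ hl => tailWeight_congr h hl

/-- Positivity of the summands: if `Deg > 0` on the non-empty subsets of `s` (the printed "Deg(s) > 0") then every summand of W(s) is
positive. [cite: Volkov2017, §III.B eq. (16) ("where Deg(s) > 0 is defined for each set s …")] -/
theorem tailWeight_pos {Deg : Finset ι → ℝ} {s : Finset ι} (hDeg : ∀ t : Finset ι, t.Nonempty → t ⊆ s → 0 < Deg t)
    {l : List ι} (hl : l ∈ orderings s) : 0 < tailWeight Deg l := by
  induction l generalizing s with
  | nil => exact one_pos
  | cons j t ih =>
    obtain ⟨hj, ht⟩ := mem_orderings_cons.mp hl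
    have hset : (j :: t).toFinset = s := (mem_orderings.mp hl).2
    rw [tailWeight_cons, hset]
    exact div_pos (ih (fun u hu hus => hDeg u hu (hus.trans (erase_subset j s))) ht) (hDeg s ⟨j, hj⟩ Subset.rfl)

/-- `W(s) > 0` whenever `Deg > 0` on the non-empty subsets of `s`. [cite: Volkov2017, §III.C eq. (23) with §III.B "Deg(s) > 0"] -/
theorem tableW_pos {Deg : Finset ι → ℝ} {s : Finset ι} (hDeg : ∀ t : Finset ι, t.Nonempty → t ⊆ s → 0 < Deg t) :
    0 < tableW Deg s :=
  sum_pos (fun _ hl => tailWeight_pos hDeg hl) (orderings_nonempty s)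

/-- **The whole-integral normaliser** "∫_{z>0} g₀ δ(Σz − 1) dz … equals Σ_{a∈Λ} W(Λ∖{a})" — the printed VALUE, typed as a function of
the table. [cite: Volkov2017, §III.C (display after eq. (24), tex l.973–982)] -/
noncomputable def totalW (Deg : Finset ι → ℝ) (Λ : Finset ι) : ℝ := ∑ a ∈ Λ, tableW Deg (Λ.erase a)

/-- The normaliser is positive as soon as `Λ ≠ ∅` and `Deg > 0` on the non-empty PROPER subsets of `Λ` — exactly the sets on which
Volkov fixes Deg. [cite: Volkov2017, §III.C ("Suppose the numbers Deg(s) are fixed for each s ⊆ Λ, s ≠ Λ, s ≠ ∅") and §III.B "Deg(s) > 0"] -/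
theorem totalW_pos {Deg : Finset ι → ℝ} {Λ : Finset ι} (hΛ : Λ.Nonempty)
    (hDeg : ∀ t : Finset ι, t.Nonempty → t ⊂ Λ → 0 < Deg t) : 0 < totalW Deg Λ :=
  sum_pos (fun _ ha => tableW_pos fun t ht hts => hDeg t ht (lt_of_le_of_lt hts (erase_ssubset ha))) hΛ

/-- (23) read as "Deg(s) · W(s) = Σ_{l∈s} W(s∖{l})": for non-empty `s` with `Deg s ≠ 0`, `totalW Deg s = Deg s * tableW Deg s`.
[cite: Volkov2017, §III.C eq. (23)] -/
theorem totalW_eq_mul_tableW (Deg : Finset ι → ℝ) {s : Finset ι} (hs : s.Nonempty) (hD : Deg s ≠ 0) :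
    totalW Deg s = Deg s * tableW Deg s := by
  rw [tableW_eq Deg hs, totalW, mul_div_cancel₀ _ hD]

/-- **Eq. (24), the step law**: "the probability that j_l = a is equal to P[Λ∖{j₁,…,j_{l−1}}, a], where
P[s,a] = W(s∖{a}) / Σ_{a′∈s} W(s∖{a′})". [cite: Volkov2017, §III.C eq. (24) `eq_next_prob` (tex l.948–954)] -/
noncomputable def nextProb (Deg : Finset ι → ℝ) (s : Finset ι) (a : ι) : ℝ :=
  tableW Deg (s.erase a) / ∑ a' ∈ s, tableW Deg (s.erase a')

/-- `P[s,a] = W(s∖{a}) / totalW(s)` (the denominator of (24) is the normaliser of the display after it, at `Λ = s`).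
[cite: Volkov2017, §III.C eq. (24)] -/
theorem nextProb_eq (Deg : Finset ι → ℝ) (s : Finset ι) (a : ι) :
    nextProb Deg s a = tableW Deg (s.erase a) / totalW Deg s := rfl

/-- `P[s, ·]` is a probability vector on `s` (whenever its denominator is non-zero, e.g. under `totalW_pos`).
[cite: Volkov2017, §III.C eq. (24) ("put j_l = a with the probability P[…, a]")] -/
theorem sum_nextProb (Deg : Finset ι → ℝ) {s : Finset ι} (h : totalW Deg s ≠ 0) : ∑ a ∈ s, nextProb Deg s a = 1 := by
  simp only [nextProb_eq]
  rw [← sum_div]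
  exact div_self h

/-- `P[s,a] ≥ 0` under the printed positivity of Deg. [cite: Volkov2017, §III.C eq. (24)] -/
theorem nextProb_nonneg {Deg : Finset ι → ℝ} {s : Finset ι} (hDeg : ∀ t : Finset ι, t.Nonempty → t ⊂ s → 0 < Deg t)
    {a : ι} (ha : a ∈ s) : 0 ≤ nextProb Deg s a := by
  rw [nextProb_eq]
  exact div_nonneg (tableW_pos fun t ht hts => hDeg t ht (lt_of_le_of_lt hts (erase_ssubset ha))).le
    (totalW_pos ⟨a, ha⟩ hDeg).le

end Table

/-! ## The sector law of the generation loop -/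

section Generation

/-- **The printed value of (19)**: for the sector `S_{j₁,…,j_n}` = the list `[j₁, …, j_n]`, "∫_{S} g₀ δ(Σz−1) dz … equals
1/∏_{l=2}^{n} Deg({j_l, j_{l+1}, …, j_n})" — one factor per PROPER tail set (the `tailWeight` of the list's tail). (`1` on the empty
list, an empty product; no sector has `n = 0`.) [cite: Volkov2017, §III.C (display after eq. (22) `eq_subst_yt`, tex l.930–933)] -/
noncomputable def sectorIntegral (Deg : Finset ι → ℝ) : List ι → ℝ
  | [] => 1
  | _ :: t => tailWeight Deg t

/-- `sectorIntegral Deg (j :: t) = tailWeight Deg t`. [cite: Volkov2017, §III.C (display after eq. (22))] -/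
@[simp] theorem sectorIntegral_cons (Deg : Finset ι → ℝ) (j : ι) (t : List ι) :
    sectorIntegral Deg (j :: t) = tailWeight Deg t := rfl

/-- Consistency of the two printed closed forms: summing the sector values 1/∏_{l≥2} Deg over ALL sectors of a non-empty Λ gives the
printed whole-integral value Σ_{a∈Λ} W(Λ∖{a}) (group the sectors by j₁ = a). [cite: Volkov2017, §III.C (displays after eq. (22) and
after eq. (24))] -/
theorem sum_sectorIntegral (Deg : Finset ι → ℝ) {Λ : Finset ι} (hΛ : Λ.Nonempty) :
    ∑ l ∈ orderings Λ, sectorIntegral Deg l = totalW Deg Λ := by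
  rw [sum_orderings_eq hΛ]
  rfl

/-- **"Generation of a sector. for l := 1 to n do put j_l = a with the probability P[Λ∖{j₁,…,j_{l−1}}, a]"**: the probability that
the loop, run on the remaining set `Λ`, outputs the label sequence `l` (product of the step probabilities (24) along the run; `0` for
sequences the loop cannot produce). [cite: Volkov2017, §III.C "The algorithm", Generation part 1 (tex l.993–998)] -/
noncomputable def genProb (Deg : Finset ι → ℝ) : Finset ι → List ι → ℝ
  | Λ, [] => if Λ = ∅ then 1 else 0
  | Λ, j :: t => (if j ∈ Λ then nextProb Deg Λ j else 0) * genProb Deg (Λ.erase j) t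

/-- The telescoping behind "To generate sectors with correct probabilities": for a sector `j :: t` of `Λ`,
`genProb · Σ_{a∈Λ} W(Λ∖{a}) = 1/∏_{l≥2} Deg` (each step's numerator W(s∖{a}) is, by (23), the next step's denominator divided by the
next Deg). Hypothesis: `Deg > 0` on the non-empty proper subsets of `Λ`. [cite: Volkov2017, §III.C eqs. (23)–(24) and Generation part 1] -/
theorem genProb_cons_mul_totalW {Deg : Finset ι → ℝ} {Λ : Finset ι}
    (hDeg : ∀ s : Finset ι, s.Nonempty → s ⊂ Λ → 0 < Deg s) {j : ι} {t : List ι} (hl : j :: t ∈ orderings Λ) :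
    genProb Deg Λ (j :: t) * totalW Deg Λ = tailWeight Deg t := by
  induction t generalizing Λ j with
  | nil =>
    obtain ⟨hj, hnil⟩ := mem_orderings_cons.mp hl
    have hΛj : Λ.erase j = ∅ := by
      obtain ⟨-, h⟩ := mem_orderings.mp hnil
      rw [List.toFinset_nil] at h
      exact h.symm
    have htot : totalW Deg Λ ≠ 0 := (totalW_pos ⟨j, hj⟩ hDeg).ne'
    rw [genProb, if_pos hj, genProb, hΛj, if_pos rfl, mul_one, nextProb_eq, hΛj, tableW_empty, tailWeight_nil]
    exact div_mul_cancel₀ 1 htot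
  | cons j' t' ih =>
    obtain ⟨hj, hl'⟩ := mem_orderings_cons.mp hl
    have hj' : j' ∈ Λ.erase j := (mem_orderings_cons.mp hl').1
    have hΛ' : (Λ.erase j).Nonempty := ⟨j', hj'⟩
    have hsub : Λ.erase j ⊂ Λ := erase_ssubset hj
    have hDeg' : ∀ s : Finset ι, s.Nonempty → s ⊂ Λ.erase j → 0 < Deg s := fun s hs hss => hDeg s hs (hss.trans hsub)
    have htot : totalW Deg Λ ≠ 0 := (totalW_pos ⟨j, hj⟩ hDeg).ne'
    have hset : (j' :: t').toFinset = Λ.erase j := (mem_orderings.mp hl').2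
    have ih' : genProb Deg (Λ.erase j) (j' :: t') * totalW Deg (Λ.erase j) = tailWeight Deg t' := ih hDeg' hl'
    have hW : tableW Deg (Λ.erase j) = totalW Deg (Λ.erase j) / Deg (Λ.erase j) := tableW_eq Deg hΛ'
    rw [genProb, if_pos hj, tailWeight_cons, hset, nextProb_eq, hW, ← ih']
    field_simp

/-- **The sector law**: the generation loop outputs the sector `S_{j₁,…,j_n}` with probability
`[1/∏_{l=2}^{n} Deg({j_l,…,j_n})] / Σ_{a∈Λ} W(Λ∖{a})` — the printed value of the sector integral (19) over the printed value of the
whole integral of g₀, i.e. "sectors with correct probabilities" for the density g = g₀/∫g₀ — whenever `Deg > 0` on the non-empty proper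
subsets of Λ. [cite: Volkov2017, §III.C eq. (19), the displays after (22) and (24), Generation part 1] -/
theorem genProb_eq {Deg : Finset ι → ℝ} {Λ : Finset ι} (hDeg : ∀ s : Finset ι, s.Nonempty → s ⊂ Λ → 0 < Deg s)
    {j : ι} {t : List ι} (hl : j :: t ∈ orderings Λ) :
    genProb Deg Λ (j :: t) = sectorIntegral Deg (j :: t) / totalW Deg Λ := by
  have htot : totalW Deg Λ ≠ 0 := (totalW_pos ⟨j, (mem_orderings_cons.mp hl).1⟩ hDeg).ne'
  rw [eq_div_iff htot, sectorIntegral_cons]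
  exact genProb_cons_mul_totalW hDeg hl

/-- The sector law is a probability vector on the sectors of a non-empty Λ. [cite: Volkov2017, §III.C Generation part 1 with eqs.
(23)–(24)] -/
theorem sum_genProb {Deg : Finset ι → ℝ} {Λ : Finset ι} (hΛ : Λ.Nonempty)
    (hDeg : ∀ s : Finset ι, s.Nonempty → s ⊂ Λ → 0 < Deg s) : ∑ l ∈ orderings Λ, genProb Deg Λ l = 1 := by
  have htot : totalW Deg Λ ≠ 0 := (totalW_pos hΛ hDeg).ne'
  calc ∑ l ∈ orderings Λ, genProb Deg Λ l = ∑ l ∈ orderings Λ, sectorIntegral Deg l / totalW Deg Λ := by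
        rw [sum_orderings_eq hΛ, sum_orderings_eq hΛ]
        exact sum_congr rfl fun e he => sum_congr rfl fun t ht => genProb_eq hDeg (mem_orderings_cons.mpr ⟨he, ht⟩)
    _ = 1 := by rw [← sum_div, sum_sectorIntegral Deg hΛ, div_self htot]

/-- The loop's law is non-negative on sectors. [cite: Volkov2017, §III.C Generation part 1] -/
theorem genProb_nonneg {Deg : Finset ι → ℝ} {Λ : Finset ι} (hDeg : ∀ s : Finset ι, s.Nonempty → s ⊂ Λ → 0 < Deg s)
    {l : List ι} (hl : l ∈ orderings Λ) : 0 ≤ genProb Deg Λ l := by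
  cases l with
  | nil =>
    obtain ⟨-, h⟩ := mem_orderings.mp hl
    rw [List.toFinset_nil] at h
    rw [genProb, if_pos h.symm]
    exact zero_le_one
  | cons j t =>
    rw [genProb_eq hDeg hl, sectorIntegral_cons]
    have hj : j ∈ Λ := (mem_orderings_cons.mp hl).1
    refine div_nonneg (tailWeight_pos (s := Λ.erase j) (fun u hu hus => hDeg u hu ?_) (mem_orderings_cons.mp hl).2).le
      (totalW_pos ⟨j, hj⟩ hDeg).le
    exact lt_of_le_of_lt hus (erase_ssubset hj)

end Generation

/-! ## Dictionary: Volkov 2017 §III.C ↔ Borinsky 2020 §6.2 (Definition 28, Proposition 29, Algorithm 4)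

Borinsky's table uses one factor per PROPER tail set INCLUDING the empty one, with the printed convention "declare r(∅) = 1"; Volkov's
summand uses one factor per NON-EMPTY tail set including the full one. With `r = Deg` and `Deg ∅ = 1` the two differ by the single
factor `Deg(s)`. -/

section Dictionary

/-- Per ordering: `tailWeight Deg l = orderingWeight Deg l / Deg(l.toFinset)` under Borinsky's convention `Deg ∅ = 1`.
[cite: Borinsky2020, §6.2 eq. (40) and Definition 28 ("declare r(∅) = 1")] -/
theorem tailWeight_eq_orderingWeight_div {Deg : Finset ι → ℝ} (h0 : Deg ∅ = 1) :
    ∀ l : List ι, tailWeight Deg l = orderingWeight Deg l / Deg l.toFinset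
  | [] => by rw [tailWeight_nil, orderingWeight_nil, List.toFinset_nil, h0, div_one]
  | j :: t => by rw [tailWeight_cons, orderingWeight_cons, tailWeight_eq_orderingWeight_div h0 t]

/-- **W(s) = J_{Deg}(s) / Deg(s)**: Volkov's table (23) is Borinsky's `2ⁿ`-table of Definition 28 divided by the top factor (for every
`s`, under `Deg ∅ = 1`; by `tableW_congr` the left side does not see that convention). [cite: Volkov2017, §III.C eq. (23)]
[cite: Borinsky2020, §6.2 Definition 28 and proof of Proposition 29] -/
theorem tableW_eq_sectorTable_div {Deg : Finset ι → ℝ} (h0 : Deg ∅ = 1) (s : Finset ι) :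
    tableW Deg s = sectorTable Deg s / Deg s := by
  rw [tableW, sectorTable_eq_sum_orderingWeight, sum_div]
  exact sum_congr rfl fun l hl => by rw [tailWeight_eq_orderingWeight_div h0, (mem_orderings.mp hl).2]

/-- **Σ_{a∈Λ} W(Λ∖{a}) = J_{Deg}(Λ)**: Volkov's whole-integral normaliser is Borinsky's `I^tr = J_r([n])` (Proposition 29), for
non-empty Λ under `Deg ∅ = 1`. [cite: Volkov2017, §III.C (display after eq. (24))] [cite: Borinsky2020, §6.2 Proposition 29] -/
theorem totalW_eq_sectorTable {Deg : Finset ι → ℝ} (h0 : Deg ∅ = 1) {Λ : Finset ι} (hΛ : Λ.Nonempty) :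
    totalW Deg Λ = sectorTable Deg Λ := by
  rw [totalW, sectorTable_eq Deg hΛ]
  exact sum_congr rfl fun a _ => tableW_eq_sectorTable_div h0 _

/-- **P[s,a] = p_a**: Volkov's step law (24) is Borinsky's Algorithm-4 step law "p_e = (1/J_r(A)) · J_r(A∖e)/r(A∖e)" (non-empty `s`,
`Deg ∅ = 1`). [cite: Volkov2017, §III.C eq. (24)] [cite: Borinsky2020, §6.2 Algorithm 4] -/
theorem nextProb_eq_stepProb {Deg : Finset ι → ℝ} (h0 : Deg ∅ = 1) {s : Finset ι} (hs : s.Nonempty) (a : ι) :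
    nextProb Deg s a = stepProb Deg s a := by
  rw [nextProb_eq, stepProb, totalW_eq_sectorTable h0 hs, tableW_eq_sectorTable_div h0]

/-- The two sector-generation loops have the same law (`Deg ∅ = 1`). [cite: Volkov2017, §III.C Generation part 1]
[cite: Borinsky2020, §6.2 Algorithm 4] -/
theorem genProb_eq_runProb {Deg : Finset ι → ℝ} (h0 : Deg ∅ = 1) :
    ∀ (Λ : Finset ι) (l : List ι), genProb Deg Λ l = runProb Deg Λ l
  | Λ, [] => by rw [genProb, runProb]
  | Λ, j :: t => by
    rw [genProb, runProb, genProb_eq_runProb h0 (Λ.erase j) t]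
    by_cases hj : j ∈ Λ
    · rw [if_pos hj, if_pos hj, nextProb_eq_stepProb h0 ⟨j, hj⟩]
    · rw [if_neg hj, if_neg hj]

/-- Volkov's printed sector value 1/∏_{l≥2} Deg = Borinsky's per-sector normalisation `I^tr_{C_σ} = 1/∏_{k=1}^{n−1} r(A^σ_k)` of
eq. (40) (`Deg ∅ = 1`). [cite: Volkov2017, §III.C (display after eq. (22))] [cite: Borinsky2020, §6.2 eq. (40)] -/
theorem sectorIntegral_eq_orderingWeight {Deg : Finset ι → ℝ} (h0 : Deg ∅ = 1) :
    ∀ l : List ι, sectorIntegral Deg l = orderingWeight Deg l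
  | [] => rfl
  | j :: t => by rw [sectorIntegral_cons, orderingWeight_cons, tailWeight_eq_orderingWeight_div h0]

end Dictionary

end Literature.MathematicalPhysics.QuantumFieldTheory.Volkov2017
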